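import Mathlib
import Summits.MatrixMultiplication.MatrixMultiplication.Theorems.SnSubsetDichotomyNoThresholdSubsetTripleDriftHypothesisDefs
import Summits.MatrixMultiplication.MatrixMultiplication.Theorems.SnSubsetDichotomyNoThresholdSubsetTripleTimeSumTailTwo
import Summits.MatrixMultiplication.MatrixMultiplication.Theorems.SnSubsetDichotomyNoThresholdSubsetTriplePlancherelGrowthDefs
import Summits.MatrixMultiplication.MatrixMultiplication.Theorems.SnSubsetDichotomyNoThresholdSubsetTriplePairMeasureBasic
import Summits.MatrixMultiplication.MatrixMultiplication.Theorems.SnSubsetDichotomyNoThresholdSubsetTripleCondExpPrefixParam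
import Summits.MatrixMultiplication.MatrixMultiplication.Theorems.SnSubsetDichotomyNoThresholdSubsetTripleStoppedProcess
import Summits.MatrixMultiplication.MatrixMultiplication.Theorems.SnSubsetDichotomyNoThresholdSubsetTripleShapeBeforeDefs
import Summits.MatrixMultiplication.MatrixMultiplication.Theorems.SnSubsetDichotomyNoThresholdSubsetTriplePlancherelStepDefs

/-!
# (Q) for the Plancherel growth modulo the drift hypothesis (L1*)

Line `klr-graded-polynomial-method`, crux `SnSubsetDichotomy.NoThresholdSubsetTriple` (stmt-MatrixMultiplication-8302),
stub `pairQV_tail_of_drift` — the capstone of the (Q)-programme (lead c7 report §2a).  Assuming the drift hypothesis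
`PlancherelStep.DriftHypothesis` (a Lyapunov shape functional `V ≥ 0`, `V ∅ = 0`, restoring against `q = sqEnergy` on
the `3√n`-box with increments `≤ b√n` and conditional second moment `≤ C(q+1)`), the number of same-shape tableau pairs
`ω : TableauPair n` whose shape lies in the `3√n`-box and whose growth `ν_t = shapeBefore (ω.2.2).1 t` has time-summed
energy `Σ_{t<n} q(ν_t) ≥ A·n·√n` is at most `n! · 2·exp(−κ A √n)` for `A ≥ A₀`, `κ = min(c/(8b), c²/(35C))`.

Proof (assembly of the tree): on the uniform probability space `pairMeasure n` with the prefix filtration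
(`pairMeasure_basic`), apply the two-process (Q)-lemma `selfBounding_timeSum_tail_two` to the Lyapunov process
`W_t = V(ν_t)` frozen at the exit from the box (`stopped_process_exists`) and the summed process
`q_t = [t < n][ν_t boxed]·sqEnergy ν_t`; its drift and second-moment hypotheses are the drift hypothesis transported
along the Markov property of the prefix shapes (`condExp_prefix_succ_param`, `shapeBefore_api`), the increment bound is
pointwise.  On the target event the whole growth is boxed (prefix shapes are subsets of the final shape), so `q_t = q(ν_t)`
there, and `μ.real E = #E / n!` converts the tail bound into the count.  The box predicate
`∀ x ∈ Y, x.1 < 3√n ∧ x.2 < 3√n` is kept verbatim throughout (no auxiliary definitions).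
-/

open MeasureTheory ProbabilityTheory
open scoped BigOperators ENNReal
open Literature.RepresentationTheory.FiniteGroups (addableNodes IsAddableNode TableauPair)
open Literature.NumberTheory.DiophantineGeometry (StdFilling)

namespace Summit.MatrixMultiplication.MatrixMultiplication.Theorems

open PlancherelStep PlancherelGrowth

/-! ### The summed functional `q_t(Y) = [t < n][Y boxed]·sqEnergy Y` -/

set_option linter.dupNamespace false in
/-- `q_t ≥ 0` (`sqEnergy ≥ 0`). -/
private theorem q_nonneg (n t : ℕ) (Y : Finset (ℕ × ℕ)) :
    (0 : ℝ) ≤ if t < n then (if (∀ x ∈ Y, (x.1 : ℝ) < 3 * Real.sqrt n ∧ (x.2 : ℝ) < 3 * Real.sqrt n)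
      then sqEnergy Y else 0) else 0 := by
  split_ifs <;> first | exact le_rfl | exact sqEnergy_nonneg Y

set_option linter.dupNamespace false in
/-- On a boxed shape before time `n`, `q_t = sqEnergy`. -/
private theorem q_eq {n t : ℕ} {Y : Finset (ℕ × ℕ)} (ht : t < n)
    (hY : ∀ x ∈ Y, (x.1 : ℝ) < 3 * Real.sqrt n ∧ (x.2 : ℝ) < 3 * Real.sqrt n) :
    (if t < n then (if (∀ x ∈ Y, (x.1 : ℝ) < 3 * Real.sqrt n ∧ (x.2 : ℝ) < 3 * Real.sqrt n)
      then sqEnergy Y else 0) else 0) = sqEnergy Y := by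
  rw [if_pos ht, if_pos hY]

/-! ### The drift hypothesis, pointwise, for the frozen increment and `q_t` -/

set_option linter.dupNamespace false in
/-- (L1) pointwise: `Σ_z p_z · [Y boxed](V(Y ∪ z) − V(Y)) ≤ K' − c·q_t(Y)/√n` for a Young diagram `Y` with at most `n`
cells and `t < n` (boxed: the drift hypothesis and `K ≤ K'`; unboxed: `0 ≤ K'`). -/
private theorem drift_sum_le {n t : ℕ} (V : Finset (ℕ × ℕ) → ℝ) (K K' c : ℝ) (hKK' : K ≤ K') (hK'0 : 0 ≤ K')
    (hyp1 : ∀ ν : Finset (ℕ × ℕ), IsLowerSet (ν : Set (ℕ × ℕ)) → ν.card ≤ n →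
      (∀ x ∈ ν, (x.1 : ℝ) < 3 * Real.sqrt n ∧ (x.2 : ℝ) < 3 * Real.sqrt n) →
        ∑ z ∈ addableNodes ν, transProb ν z * (V (insert z ν) - V ν) ≤ K - c * sqEnergy ν / Real.sqrt n)
    (Y : Finset (ℕ × ℕ)) (hlow : IsLowerSet (Y : Set (ℕ × ℕ))) (hcard : Y.card ≤ n) (ht : t < n) :
    ∑ z ∈ addableNodes Y, transProb Y z *
        (if (∀ x ∈ Y, (x.1 : ℝ) < 3 * Real.sqrt n ∧ (x.2 : ℝ) < 3 * Real.sqrt n)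
          then V (insert z Y) - V Y else 0) ≤
      K' - c * (if t < n then (if (∀ x ∈ Y, (x.1 : ℝ) < 3 * Real.sqrt n ∧ (x.2 : ℝ) < 3 * Real.sqrt n)
        then sqEnergy Y else 0) else 0) / Real.sqrt n := by
  by_cases hbx : ∀ x ∈ Y, (x.1 : ℝ) < 3 * Real.sqrt n ∧ (x.2 : ℝ) < 3 * Real.sqrt n
  · simp only [if_pos hbx, if_pos ht]
    exact (hyp1 Y hlow hcard hbx).trans (sub_le_sub_right hKK' _)
  · simp only [if_neg hbx, ite_self, mul_zero, Finset.sum_const_zero, zero_div, sub_zero]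
    exact hK'0

set_option linter.dupNamespace false in
/-- (L3) pointwise: `Σ_z p_z · ([Y boxed](V(Y ∪ z) − V(Y)))² ≤ C·(q_t(Y) + 1)` for a Young diagram `Y` with at most
`n` cells and `t < n` (boxed: the drift hypothesis; unboxed: `0 ≤ C`). -/
private theorem sq_sum_le {n t : ℕ} (V : Finset (ℕ × ℕ) → ℝ) (C : ℝ) (hC : 0 < C)
    (hyp3 : ∀ ν : Finset (ℕ × ℕ), IsLowerSet (ν : Set (ℕ × ℕ)) → ν.card ≤ n →
      (∀ x ∈ ν, (x.1 : ℝ) < 3 * Real.sqrt n ∧ (x.2 : ℝ) < 3 * Real.sqrt n) →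
        ∑ z ∈ addableNodes ν, transProb ν z * (V (insert z ν) - V ν) ^ 2 ≤ C * (sqEnergy ν + 1))
    (Y : Finset (ℕ × ℕ)) (hlow : IsLowerSet (Y : Set (ℕ × ℕ))) (hcard : Y.card ≤ n) (ht : t < n) :
    ∑ z ∈ addableNodes Y, transProb Y z *
        (if (∀ x ∈ Y, (x.1 : ℝ) < 3 * Real.sqrt n ∧ (x.2 : ℝ) < 3 * Real.sqrt n)
          then V (insert z Y) - V Y else 0) ^ 2 ≤
      C * ((if t < n then (if (∀ x ∈ Y, (x.1 : ℝ) < 3 * Real.sqrt n ∧ (x.2 : ℝ) < 3 * Real.sqrt n)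
        then sqEnergy Y else 0) else 0) + 1) := by
  by_cases hbx : ∀ x ∈ Y, (x.1 : ℝ) < 3 * Real.sqrt n ∧ (x.2 : ℝ) < 3 * Real.sqrt n
  · simp only [if_pos hbx, if_pos ht]
    exact hyp3 Y hlow hcard hbx
  · have h0 : ∀ p : ℝ, p * (0 : ℝ) ^ 2 = 0 := fun p => by ring
    simp only [if_neg hbx, ite_self, h0, Finset.sum_const_zero, zero_add, mul_one]
    exact hC.le

/-! ### Prefix shapes: stationarity after time `n`, inclusion in the final shape, key-measurability -/

set_option linter.dupNamespace false in
/-- After time `n` the growth is over: all `n` entries are `< t`, so `shapeBefore f (t+1) = shapeBefore f t`. -/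
private theorem shapeBefore_succ_of_le {n : ℕ} (f : Fin n → ℕ × ℕ) {t : ℕ} (ht : n ≤ t) :
    shapeBefore f (t + 1) = shapeBefore f t := by
  unfold shapeBefore
  congr 1
  ext j
  simp only [Finset.mem_filter, Finset.mem_univ, true_and]
  exact ⟨fun _ => lt_of_lt_of_le j.2 ht, fun h => Nat.lt_succ_of_lt h⟩

set_option linter.dupNamespace false in
/-- Every prefix shape of the second tableau is a subset of the common shape of the pair. -/
private theorem shapeBefore_subset_cells {n : ℕ} (ω : TableauPair n) (t : ℕ) {x : ℕ × ℕ}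
    (hx : x ∈ shapeBefore (ω.2.2).1 t) : x ∈ ω.1.youngDiagram.cells := by
  simp only [shapeBefore, Finset.mem_image, Finset.mem_filter, Finset.mem_univ, true_and] at hx
  obtain ⟨j, _, rfl⟩ := hx
  exact (YoungDiagram.mem_cells _).2 ((ω.2.2).mem j)

-- adapted from the private lemma `measurable_comap_top_comp` of the tree file
-- `SnSubsetDichotomyNoThresholdSubsetTriplePairMeasureBasic.lean`
set_option linter.dupNamespace false in
/-- Any function factoring through `g` is measurable for the σ-algebra `comap g ⊤` generated by `g`. -/
private theorem qv_measurable_comap_top_comp {α β γ : Type*} [MeasurableSpace γ] (g : α → β) (h : β → γ) :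
    Measurable[MeasurableSpace.comap g ⊤] (h ∘ g) := by
  intro s _
  exact MeasurableSpace.measurableSet_comap.2 ⟨h ⁻¹' s, MeasurableSpace.measurableSet_top, rfl⟩

/-! ### The increments of the frozen Lyapunov process -/

set_option linter.dupNamespace false in
/-- The increment of the frozen process is `[ν_t boxed]·(V(ν_{t+1}) − V(ν_t))` (the two defining properties of
`stopped_process_exists` in one formula). -/
private theorem incr_eq {n : ℕ} (V : Finset (ℕ × ℕ) → ℝ) (W : ℕ → TableauPair n → ℝ)
    (hWbox : ∀ (t : ℕ) (ω : TableauPair n),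
      (∀ x ∈ shapeBefore (ω.2.2).1 t, (x.1 : ℝ) < 3 * Real.sqrt n ∧ (x.2 : ℝ) < 3 * Real.sqrt n) →
        W (t + 1) ω - W t ω = V (shapeBefore (ω.2.2).1 (t + 1)) - V (shapeBefore (ω.2.2).1 t))
    (hWout : ∀ (t : ℕ) (ω : TableauPair n),
      ¬ (∀ x ∈ shapeBefore (ω.2.2).1 t, (x.1 : ℝ) < 3 * Real.sqrt n ∧ (x.2 : ℝ) < 3 * Real.sqrt n) →
        W (t + 1) ω - W t ω = 0)
    (t : ℕ) (ω : TableauPair n) :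
    W (t + 1) ω - W t ω =
      if (∀ x ∈ shapeBefore (ω.2.2).1 t, (x.1 : ℝ) < 3 * Real.sqrt n ∧ (x.2 : ℝ) < 3 * Real.sqrt n)
        then V (shapeBefore (ω.2.2).1 (t + 1)) - V (shapeBefore (ω.2.2).1 t) else 0 := by
  by_cases h : ∀ x ∈ shapeBefore (ω.2.2).1 t, (x.1 : ℝ) < 3 * Real.sqrt n ∧ (x.2 : ℝ) < 3 * Real.sqrt n
  · rw [if_pos h, hWbox t ω h]
  · rw [if_neg h, hWout t ω h]

set_option linter.dupNamespace false in
/-- From time `n` on the frozen process is constant (the prefix shape is stationary). -/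
private theorem incr_eq_zero_of_le {n : ℕ} (V : Finset (ℕ × ℕ) → ℝ) (W : ℕ → TableauPair n → ℝ)
    (hW : ∀ (t : ℕ) (ω : TableauPair n), W (t + 1) ω - W t ω =
      if (∀ x ∈ shapeBefore (ω.2.2).1 t, (x.1 : ℝ) < 3 * Real.sqrt n ∧ (x.2 : ℝ) < 3 * Real.sqrt n)
        then V (shapeBefore (ω.2.2).1 (t + 1)) - V (shapeBefore (ω.2.2).1 t) else 0)
    {t : ℕ} (ht : n ≤ t) (ω : TableauPair n) : W (t + 1) ω - W t ω = 0 := by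
  rw [hW t ω, shapeBefore_succ_of_le _ ht, sub_self, ite_self]

/-! ### The three hypotheses of the two-process (Q)-lemma for the frozen process -/

set_option linter.dupNamespace false in
/-- (L1) for the frozen process: `μ[W_{t+1} − W_t | ℱ_t] ≤ K' − c·q_t/√n` a.e. (for `t < n` by the Markov property
`condExp_prefix_succ_param` and the pointwise bound `drift_sum_le`; for `t ≥ n` both sides are trivial). -/
private theorem condExp_incr_le {n : ℕ} (V : Finset (ℕ × ℕ) → ℝ) (K K' c : ℝ) (hKK' : K ≤ K') (hK'0 : 0 ≤ K')
    (hyp1 : ∀ ν : Finset (ℕ × ℕ), IsLowerSet (ν : Set (ℕ × ℕ)) → ν.card ≤ n →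
      (∀ x ∈ ν, (x.1 : ℝ) < 3 * Real.sqrt n ∧ (x.2 : ℝ) < 3 * Real.sqrt n) →
        ∑ z ∈ addableNodes ν, transProb ν z * (V (insert z ν) - V ν) ≤ K - c * sqEnergy ν / Real.sqrt n)
    (W : ℕ → TableauPair n → ℝ)
    (hW : ∀ (t : ℕ) (ω : TableauPair n), W (t + 1) ω - W t ω =
      if (∀ x ∈ shapeBefore (ω.2.2).1 t, (x.1 : ℝ) < 3 * Real.sqrt n ∧ (x.2 : ℝ) < 3 * Real.sqrt n)
        then V (shapeBefore (ω.2.2).1 (t + 1)) - V (shapeBefore (ω.2.2).1 t) else 0)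
    (t : ℕ) :
    (pairMeasure n)[fun ω => W (t + 1) ω - W t ω | prefixFiltration n t] ≤ᵐ[pairMeasure n]
      fun ω => K' - c * (if t < n then
        (if (∀ x ∈ shapeBefore (ω.2.2).1 t, (x.1 : ℝ) < 3 * Real.sqrt n ∧ (x.2 : ℝ) < 3 * Real.sqrt n)
          then sqEnergy (shapeBefore (ω.2.2).1 t) else 0) else 0) / Real.sqrt n := by
  by_cases ht : t < n
  · have hfun : (fun ω => W (t + 1) ω - W t ω) = fun ω : TableauPair n =>
        (fun Y Y' : Finset (ℕ × ℕ) =>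
            if (∀ x ∈ Y, (x.1 : ℝ) < 3 * Real.sqrt n ∧ (x.2 : ℝ) < 3 * Real.sqrt n) then V Y' - V Y else 0)
          (shapeBefore (ω.2.2).1 t) (shapeBefore (ω.2.2).1 (t + 1)) :=
      funext fun ω => hW t ω
    rw [hfun]
    exact (condExp_prefix_succ_param n t ht fun Y Y' : Finset (ℕ × ℕ) =>
        if (∀ x ∈ Y, (x.1 : ℝ) < 3 * Real.sqrt n ∧ (x.2 : ℝ) < 3 * Real.sqrt n) then V Y' - V Y else 0).trans_le
      (Filter.Eventually.of_forall fun ω =>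
        drift_sum_le V K K' c hKK' hK'0 hyp1 _
          ((shapeBefore_api n _ ω.2.2 ω.1.card_cells_youngDiagram).2.2.2.1 t)
          (((shapeBefore_api n _ ω.2.2 ω.1.card_cells_youngDiagram).2.2.1 t ht.le).trans_le ht.le) ht)
  · have hfun : (fun ω => W (t + 1) ω - W t ω) = (0 : TableauPair n → ℝ) :=
      funext fun ω => incr_eq_zero_of_le V W hW (not_lt.1 ht) ω
    rw [hfun, condExp_zero]
    exact Filter.Eventually.of_forall fun ω => by
      show (0 : ℝ) ≤ K' - c * (if t < n then
        (if (∀ x ∈ shapeBefore (ω.2.2).1 t, (x.1 : ℝ) < 3 * Real.sqrt n ∧ (x.2 : ℝ) < 3 * Real.sqrt n)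
          then sqEnergy (shapeBefore (ω.2.2).1 t) else 0) else 0) / Real.sqrt n
      rw [if_neg ht, mul_zero, zero_div, sub_zero]
      exact hK'0

set_option linter.dupNamespace false in
/-- (L2) for the frozen process: `|W_{t+1} − W_t| ≤ b√n` (boxed and `t < n`: the increment is `V(ν_t ∪ z) − V(ν_t)`
for the addable node `z = T t`, `shapeBefore_api`; otherwise it vanishes). -/
private theorem abs_incr_le {n : ℕ} (V : Finset (ℕ × ℕ) → ℝ) (b : ℝ) (hb : 0 < b)
    (hyp2 : ∀ ν : Finset (ℕ × ℕ), IsLowerSet (ν : Set (ℕ × ℕ)) → ν.card ≤ n →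
      (∀ x ∈ ν, (x.1 : ℝ) < 3 * Real.sqrt n ∧ (x.2 : ℝ) < 3 * Real.sqrt n) →
        ∀ z ∈ addableNodes ν, |V (insert z ν) - V ν| ≤ b * Real.sqrt n)
    (W : ℕ → TableauPair n → ℝ)
    (hW : ∀ (t : ℕ) (ω : TableauPair n), W (t + 1) ω - W t ω =
      if (∀ x ∈ shapeBefore (ω.2.2).1 t, (x.1 : ℝ) < 3 * Real.sqrt n ∧ (x.2 : ℝ) < 3 * Real.sqrt n)
        then V (shapeBefore (ω.2.2).1 (t + 1)) - V (shapeBefore (ω.2.2).1 t) else 0)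
    (t : ℕ) (ω : TableauPair n) : |W (t + 1) ω - W t ω| ≤ b * Real.sqrt n := by
  have hb' : 0 ≤ b * Real.sqrt n := mul_nonneg hb.le (Real.sqrt_nonneg _)
  by_cases ht : t < n
  · by_cases hbx : ∀ x ∈ shapeBefore (ω.2.2).1 t, (x.1 : ℝ) < 3 * Real.sqrt n ∧ (x.2 : ℝ) < 3 * Real.sqrt n
    · have hA := shapeBefore_api n _ ω.2.2 ω.1.card_cells_youngDiagram
      rw [hW t ω, if_pos hbx, hA.2.1 t ht]
      exact hyp2 _ (hA.2.2.2.1 t) ((hA.2.2.1 t ht.le).trans_le ht.le) hbx _ (hA.2.2.2.2 t ht)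
    · rw [hW t ω, if_neg hbx, abs_zero]
      exact hb'
  · rw [incr_eq_zero_of_le V W hW (not_lt.1 ht) ω, abs_zero]
    exact hb'

set_option linter.dupNamespace false in
/-- (L3) for the frozen process: `μ[(W_{t+1} − W_t)² | ℱ_t] ≤ C·(q_t + 1)` a.e. (for `t < n` by the Markov property
`condExp_prefix_succ_param` and the pointwise bound `sq_sum_le`; for `t ≥ n` both sides are trivial). -/
private theorem condExp_incr_sq_le {n : ℕ} (V : Finset (ℕ × ℕ) → ℝ) (C : ℝ) (hC : 0 < C)
    (hyp3 : ∀ ν : Finset (ℕ × ℕ), IsLowerSet (ν : Set (ℕ × ℕ)) → ν.card ≤ n →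
      (∀ x ∈ ν, (x.1 : ℝ) < 3 * Real.sqrt n ∧ (x.2 : ℝ) < 3 * Real.sqrt n) →
        ∑ z ∈ addableNodes ν, transProb ν z * (V (insert z ν) - V ν) ^ 2 ≤ C * (sqEnergy ν + 1))
    (W : ℕ → TableauPair n → ℝ)
    (hW : ∀ (t : ℕ) (ω : TableauPair n), W (t + 1) ω - W t ω =
      if (∀ x ∈ shapeBefore (ω.2.2).1 t, (x.1 : ℝ) < 3 * Real.sqrt n ∧ (x.2 : ℝ) < 3 * Real.sqrt n)
        then V (shapeBefore (ω.2.2).1 (t + 1)) - V (shapeBefore (ω.2.2).1 t) else 0)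
    (t : ℕ) :
    (pairMeasure n)[fun ω => (W (t + 1) ω - W t ω) ^ 2 | prefixFiltration n t] ≤ᵐ[pairMeasure n]
      fun ω => C * ((if t < n then
        (if (∀ x ∈ shapeBefore (ω.2.2).1 t, (x.1 : ℝ) < 3 * Real.sqrt n ∧ (x.2 : ℝ) < 3 * Real.sqrt n)
          then sqEnergy (shapeBefore (ω.2.2).1 t) else 0) else 0) + 1) := by
  by_cases ht : t < n
  · have hfun : (fun ω => (W (t + 1) ω - W t ω) ^ 2) = fun ω : TableauPair n =>
        (fun Y Y' : Finset (ℕ × ℕ) =>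
            (if (∀ x ∈ Y, (x.1 : ℝ) < 3 * Real.sqrt n ∧ (x.2 : ℝ) < 3 * Real.sqrt n) then V Y' - V Y else 0) ^ 2)
          (shapeBefore (ω.2.2).1 t) (shapeBefore (ω.2.2).1 (t + 1)) :=
      funext fun ω => congrArg (fun x : ℝ => x ^ 2) (hW t ω)
    rw [hfun]
    exact (condExp_prefix_succ_param n t ht fun Y Y' : Finset (ℕ × ℕ) =>
        (if (∀ x ∈ Y, (x.1 : ℝ) < 3 * Real.sqrt n ∧ (x.2 : ℝ) < 3 * Real.sqrt n) then V Y' - V Y else 0) ^ 2).trans_le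
      (Filter.Eventually.of_forall fun ω =>
        sq_sum_le V C hC hyp3 _
          ((shapeBefore_api n _ ω.2.2 ω.1.card_cells_youngDiagram).2.2.2.1 t)
          (((shapeBefore_api n _ ω.2.2 ω.1.card_cells_youngDiagram).2.2.1 t ht.le).trans_le ht.le) ht)
  · have hfun : (fun ω => (W (t + 1) ω - W t ω) ^ 2) = (0 : TableauPair n → ℝ) :=
      funext fun ω => by
        show (W (t + 1) ω - W t ω) ^ 2 = 0
        rw [incr_eq_zero_of_le V W hW (not_lt.1 ht) ω, sq, mul_zero]
    rw [hfun, condExp_zero]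
    exact Filter.Eventually.of_forall fun ω => by
      show (0 : ℝ) ≤ C * ((if t < n then
        (if (∀ x ∈ shapeBefore (ω.2.2).1 t, (x.1 : ℝ) < 3 * Real.sqrt n ∧ (x.2 : ℝ) < 3 * Real.sqrt n)
          then sqEnergy (shapeBefore (ω.2.2).1 t) else 0) else 0) + 1)
      rw [if_neg ht, zero_add, mul_one]
      exact hC.le

/-! ### The theorem -/

set_option linter.dupNamespace false in
/-- **(Q) for the Plancherel growth modulo the drift hypothesis (L1\*), counting form** (stub `pairQV_tail_of_drift`
of line `klr-graded-polynomial-method`, crux `SnSubsetDichotomy.NoThresholdSubsetTriple`; capstone of the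
(Q)-programme).  If the drift hypothesis `PlancherelStep.DriftHypothesis` holds with constants `K, c, b, C`, then with
`κ = min(c/(8b), c²/(35C))` there is `A₀` such that for all `n ≥ 1` and `A ≥ A₀` the number of same-shape tableau pairs
`ω : TableauPair n` whose shape lies in the `3√n`-box and whose growth has `Σ_{t<n} sqEnergy(ν_t) ≥ A·n·√n` is at most
`n! · 2·exp(−κ A √n)`.  (Freedman's inequality via `selfBounding_timeSum_tail_two`, applied on the uniform space
`pairMeasure n` to the Lyapunov process frozen at the exit from the box, `stopped_process_exists`, whose hypotheses are
the drift hypothesis transported along the Markov property `condExp_prefix_succ_param`.) -/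
theorem pairQV_tail_of_drift : PlancherelStep.DriftHypothesis →
    ∃ κ : ℝ, 0 < κ ∧ ∃ A₀ : ℝ, ∀ n : ℕ, 1 ≤ n → ∀ A : ℝ, A₀ ≤ A →
      (Nat.card {ω : TableauPair n //
          (∀ x ∈ ω.1.youngDiagram.cells, (x.1 : ℝ) < 3 * Real.sqrt n ∧ (x.2 : ℝ) < 3 * Real.sqrt n) ∧
          A * n * Real.sqrt n ≤ ∑ t ∈ Finset.range n, sqEnergy (shapeBefore (ω.2.2).1 t)} : ℝ) ≤
        (n.factorial : ℝ) * (2 * Real.exp (-(κ * A * Real.sqrt n))) := by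
  rintro ⟨V, K, c, b, C, hc, hb, hC, hV0, hVnn, hyp⟩
  obtain ⟨K', hKK', hK'0⟩ : ∃ K' : ℝ, K ≤ K' ∧ 0 ≤ K' := ⟨max K 0, le_max_left _ _, le_max_right _ _⟩
  have hκ : 0 < min (c / (8 * b)) (c ^ 2 / (35 * C)) := lt_min (by positivity) (by positivity)
  refine ⟨min (c / (8 * b)) (c ^ 2 / (35 * C)), hκ,
    max (max (2 * K' / c) 1) (Real.log 2 / min (c / (8 * b)) (c ^ 2 / (35 * C))), ?_⟩
  intro n hn A hA
  -- the probability space, the filtration, the frozen Lyapunov process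
  have hbasic := pairMeasure_basic n
  haveI : IsProbabilityMeasure (pairMeasure n) := hbasic.1
  obtain ⟨W, hW0, hWbox, hWout, hWval, hWkey⟩ := stopped_process_exists n V
  have hW := incr_eq V W hWbox hWout
  -- the conditions on `A`
  have hAK : 2 * K' / c ≤ A := le_trans (le_trans (le_max_left _ _) (le_max_left _ _)) hA
  have hA1 : 1 ≤ A := le_trans (le_trans (le_max_right _ _) (le_max_left _ _)) hA
  have hlog : Real.log 2 ≤ min (c / (8 * b)) (c ^ 2 / (35 * C)) * A * Real.sqrt n := by
    have h1 : Real.log 2 ≤ min (c / (8 * b)) (c ^ 2 / (35 * C)) * A :=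
      ((div_le_iff₀ hκ).1 (le_trans (le_max_right _ _) hA)).trans_eq (mul_comm _ _)
    have hsq : 1 ≤ Real.sqrt n := Real.one_le_sqrt.2 (by exact_mod_cast hn)
    exact h1.trans (le_mul_of_one_le_right (mul_nonneg hκ.le (by linarith)) hsq)
  -- the two-process (Q)-lemma for `W` and `q_t = [t < n][ν_t boxed]·sqEnergy ν_t`
  have hbound := selfBounding_timeSum_tail_two (μ := pairMeasure n) (prefixFiltration n) W
    (fun t ω => if t < n then
      (if (∀ x ∈ shapeBefore (ω.2.2).1 t, (x.1 : ℝ) < 3 * Real.sqrt n ∧ (x.2 : ℝ) < 3 * Real.sqrt n)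
        then sqEnergy (shapeBefore (ω.2.2).1 t) else 0) else 0)
    n hn K' c b C hc hb hC
    (fun t => by
      obtain ⟨F, hF⟩ := hWkey t
      rw [hF]
      exact (qv_measurable_comap_top_comp (prefixKey n t) F).stronglyMeasurable)
    (fun t => hbasic.2.2 t fun Y => if t < n then
      (if (∀ x ∈ Y, (x.1 : ℝ) < 3 * Real.sqrt n ∧ (x.2 : ℝ) < 3 * Real.sqrt n) then sqEnergy Y else 0) else 0)
    (fun t ω => by
      obtain ⟨s, _, hs⟩ := hWval t ω
      rw [hs]
      exact hVnn _ ((shapeBefore_api n _ ω.2.2 ω.1.card_cells_youngDiagram).2.2.2.1 s))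
    (fun t ω => q_nonneg n t _)
    (fun ω => (hW0 ω).trans hV0)
    (condExp_incr_le V K K' c hKK' hK'0 (fun ν h1 h2 h3 => (hyp n ν h1 h2 h3).1) W hW)
    (abs_incr_le V b hb (fun ν h1 h2 h3 => (hyp n ν h1 h2 h3).2.1) W hW)
    (condExp_incr_sq_le V C hC (fun ν h1 h2 h3 => (hyp n ν h1 h2 h3).2.2) W hW)
    A hAK hA1 hlog
  -- the target event is contained in the (Q)-lemma's event: on it the whole growth is boxed, so `q_t = sqEnergy ν_t`
  have hsub : {ω : TableauPair n |
        (∀ x ∈ ω.1.youngDiagram.cells, (x.1 : ℝ) < 3 * Real.sqrt n ∧ (x.2 : ℝ) < 3 * Real.sqrt n) ∧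
          A * n * Real.sqrt n ≤ ∑ t ∈ Finset.range n, sqEnergy (shapeBefore (ω.2.2).1 t)} ⊆
      {ω | A * n * Real.sqrt n ≤ ∑ t ∈ Finset.range n, (if t < n then
        (if (∀ x ∈ shapeBefore (ω.2.2).1 t, (x.1 : ℝ) < 3 * Real.sqrt n ∧ (x.2 : ℝ) < 3 * Real.sqrt n)
          then sqEnergy (shapeBefore (ω.2.2).1 t) else 0) else 0)} := by
    rintro ω ⟨hbox, hsum⟩
    rw [Set.mem_setOf_eq, Finset.sum_congr rfl fun t ht => q_eq (Y := shapeBefore (ω.2.2).1 t)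
      (Finset.mem_range.1 ht) fun x hx => hbox x (shapeBefore_subset_cells ω t hx)]
    exact hsum
  have hfin : (pairMeasure n).real {ω : TableauPair n |
        (∀ x ∈ ω.1.youngDiagram.cells, (x.1 : ℝ) < 3 * Real.sqrt n ∧ (x.2 : ℝ) < 3 * Real.sqrt n) ∧
          A * n * Real.sqrt n ≤ ∑ t ∈ Finset.range n, sqEnergy (shapeBefore (ω.2.2).1 t)} ≤
      2 * Real.exp (-(min (c / (8 * b)) (c ^ 2 / (35 * C)) * A * Real.sqrt n)) :=
    (measureReal_mono hsub).trans hbound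
  -- counting: `μ.real E = #E / n!`
  have hcount : (pairMeasure n).real {ω : TableauPair n |
        (∀ x ∈ ω.1.youngDiagram.cells, (x.1 : ℝ) < 3 * Real.sqrt n ∧ (x.2 : ℝ) < 3 * Real.sqrt n) ∧
          A * n * Real.sqrt n ≤ ∑ t ∈ Finset.range n, sqEnergy (shapeBefore (ω.2.2).1 t)} =
      (Nat.card {ω : TableauPair n //
        (∀ x ∈ ω.1.youngDiagram.cells, (x.1 : ℝ) < 3 * Real.sqrt n ∧ (x.2 : ℝ) < 3 * Real.sqrt n) ∧
          A * n * Real.sqrt n ≤ ∑ t ∈ Finset.range n, sqEnergy (shapeBefore (ω.2.2).1 t)} : ℝ) / n.factorial :=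
    hbasic.2.1 _
  have hfac : (0 : ℝ) < n.factorial := by exact_mod_cast Nat.factorial_pos n
  rw [hcount, div_le_iff₀ hfac] at hfin
  exact hfin.trans_eq (mul_comm _ _)

end Summit.MatrixMultiplication.MatrixMultiplication.Theorems
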